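import Mathlib
import Summits.Parity.BatemanHorn.Theses.IsogenyRedei
import Summits.Parity.BatemanHorn.Theorems.IsogenyRedeiSplitBlockJacobiWeylDefs
import Summits.Parity.BatemanHorn.Theorems.IsogenyRedeiSplitBlockJacobiBulkReductionHolds
import Summits.Parity.BatemanHorn.Theorems.IsogenyRedeiSplitBlockJacobiPoissonReduction
import HarnessLib

/-!
# `SplitBlockJacobi` from the twisted root Weyl sum bound on the deep tiers (R1 ⇒ crux)

Crux `IsogenyRedei.SplitBlockJacobi` (stmt-Parity-11583), line `cofactor-root-discrepancy` (second lead).  With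
`stub_poissonReduction` (`…PoissonReduction`: `TierWeylBound θ μ → D^{bulk}_{θ,μ} = o(x)`) and the unconditional
reduction `splitBlockJacobi_of_bulkDiscrepancyCancels` (`…BulkReductionHolds`: R2 ⇒ crux) in the tree, the
remaining registered open stub of the line, `stub_weylDeep` (= `TierWeylBound θ μ` for all `θ ∈ (1/2,1)`,
`μ ∈ (0,2/3)`), implies the crux: `TierWeylBound θ ·` is antitone in the tier `μ` (a larger `μ` only shrinks the
box range `P₁P₂ ≤ x^{2−μ}`), so the deep tiers give every tier, Poisson gives R2, and R2 gives the crux.  This is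
the ENGINE-side currency (R1) of the line's residual, one import away for any future engine.
-/

noncomputable section

open Filter

namespace Summit.Parity.BatemanHorn.Cruxes.SplitBlockJacobi.CofactorRootDiscrepancy

/-- `TierWeylBound θ ·` is antitone: a bound down to tier `μ₀` gives every shallower tier `μ ≥ μ₀`
(the hypothesis `P₁P₂ ≤ x^{2−μ}` only gets stronger). -/
theorem tierWeylBound_mono {θ μ₀ μ : ℝ} (hle : μ₀ ≤ μ) (h : TierWeylBound θ μ₀) : TierWeylBound θ μ := by
  obtain ⟨ε₀, hε₀, x₀, hx⟩ := h
  refine ⟨ε₀, hε₀, max x₀ 1, fun x hxx P₁ P₁' P₂ P₂' h1 h2 h3 h4 h5 h6 h7 => ?_⟩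
  have hx₀ : x₀ ≤ x := le_trans (le_max_left _ _) hxx
  have hx1 : (1 : ℝ) ≤ (x : ℝ) := by exact_mod_cast le_trans (le_max_right x₀ 1) hxx
  exact hx x hx₀ P₁ P₁' P₂ P₂' h1 h2 h3 h4 h5 h6
    (h7.trans (Real.rpow_le_rpow_of_exponent_le hx1 (by linarith)))

/-- **R1 (deep tiers) ⇒ crux.**  If `TierWeylBound θ μ` holds for every `θ ∈ (1/2,1)` and every deep tier
`μ ∈ (0, 2/3)` — i.e. the registered stub `stub_weylDeep` — then `SplitBlockJacobi` holds.
Proof: antitonicity extends the bound to all `μ ∈ (0,1)`; `stub_poissonReduction` turns it into the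
`h`-summed bulk discrepancy statement R2 (through the definitional unfolding `dbulk_eq_sum`); and
`splitBlockJacobi_of_bulkDiscrepancyCancels` (stubs 1–3 discharged) gives the crux. -/
theorem splitBlockJacobi_of_weylDeep :
    (∀ θ μ : ℝ, 1 / 2 < θ → θ < 1 → 0 < μ → μ < 2 / 3 →
      Summit.Parity.BatemanHorn.Cruxes.SplitBlockJacobi.CofactorRootDiscrepancy.TierWeylBound θ μ) →
    Summit.Parity.BatemanHorn.Theses.IsogenyRedei.SplitBlockJacobi := by
  intro hW
  refine splitBlockJacobi_of_bulkDiscrepancyCancels ?_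
  intro θ μ hθ₁ hθ₂ hμ0 hμ1 ε hε
  have hT : TierWeylBound θ μ := by
    by_cases h : μ < 2 / 3
    · exact hW θ μ hθ₁ hθ₂ hμ0 h
    · exact tierWeylBound_mono (by linarith [not_lt.mp h])
        (hW θ (1 / 2) hθ₁ hθ₂ (by norm_num) (by norm_num))
  have hP := stub_poissonReduction θ μ hθ₁ hθ₂ hμ0 hμ1 hT ε hε
  simp only [dbulk_eq_sum] at hP
  exact hP

end Summit.Parity.BatemanHorn.Cruxes.SplitBlockJacobi.CofactorRootDiscrepancy

end
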